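import Literature.Analysis.PDE.QuasilinearRegularity
import Literature.Analysis.PDE.LinExist
import Literature.Analysis.PDE.LinAprioriExplicit
import Literature.Analysis.PDE.QuasilinearPatch
import HarnessLib

/-!
# Short-time existence for quasilinear strictly parabolic systems on closed manifolds: assembly
# (topic `Analysis/PDE`)

The final assembly of the programme proving hypothesis `hQL` of
`Literature.Geometry.Riemannian.ricciFlow_shortTime_existence_of_quasilinear`: from the data of
`hQL` (with values in an inner product space and a model of positive dimension) we build the
data of the frozen Picard scheme (`QuasilinearPicard.lean`) on an adapted patch system
(`QuasilinearPatch.lean`), discharge its three analytic inputs — linear existence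
(`LinExist.lean`), the weighted a priori estimate with order-independent source constant
(`LinAprioriExplicit.lean`), and the chart representation of the frozen operator
(`QuasilinearLinearization.lean`) — and read off a short-time solution
(`QuasilinearRegularity.lean`), jointly smooth on `M × [0, ε]`.

* `PatchSystemLoc.contMDiffOn_prod_of_chartSlabSmooth` — chart-slab smoothness gives joint
  smoothness on `M × [0, T]`;
* `quasilinear_shortTime_existence_core`.

Everything is proved; no named fact and no `sorry` is introduced.

## References

* M. E. Taylor, *Partial Differential Equations III*, 2nd ed., Springer 2011, Ch. 15, §7.
  [TaylorPDEIII2011]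
* C. Mantegazza, L. Martinazzi, *A note on quasilinear parabolic equations on manifolds*,
  Ann. Sc. Norm. Super. Pisa Cl. Sci. (5) 11 (2012), 857–874. [MantegazzaMartinazzi2012]
-/

noncomputable section

open Set Function Filter Topology Metric MeasureTheory InnerProductSpace
open scoped Manifold ContDiff Topology ENNReal RealInnerProductSpace

namespace Literature.Analysis.PDE

open Literature.Geometry.Manifold Literature.Analysis.FunctionSpaces Literature.Analysis.FluidPDE

/-! ### Joint smoothness on `M × [0, T]` from chart-slab smoothness -/

section Glue

variable {E : Type*} [NormedAddCommGroup E] [NormedSpace ℝ E] {H : Type*} [TopologicalSpace H]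
variable {I : ModelWithCorners ℝ E H} {M : Type*} [TopologicalSpace M] [ChartedSpace H M]
variable {E' : Type*} [NormedAddCommGroup E'] [InnerProductSpace ℝ E']
variable {W' : Type*} [NormedAddCommGroup W'] [NormedSpace ℝ W']
variable {ι : Type*} [Fintype ι]

/-- **Joint smoothness on `M × [0, T]` from chart-slab smoothness**: if every chart expression
`(s, y) ↦ G s (κ_q⁻¹ y)` is `C^∞` on `[0, T] × target_q` (within), then `(x, t) ↦ G t x` is
`C^∞` on `M × [0, T]` (within) for the product manifold structure. [cite: Lee2013, Thm. 2.23] -/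
theorem PatchSystemLoc.contMDiffOn_prod_of_chartSlabSmooth [I.Boundaryless] [IsManifold I ∞ M] (PS : PatchSystem I M E' ι)
    {T : ℝ} {G : ℝ → M → W'} (hG : ∀ q, ContDiffOn ℝ ∞ (uncurry fun s y ↦ G s ((PS.chart q).inv y)) (Icc 0 T ×ˢ (PS.chart q).target)) :
    ContMDiffOn (I.prod 𝓘(ℝ, ℝ)) 𝓘(ℝ, W') ∞ (fun p : M × ℝ ↦ G p.2 p.1) (univ ×ˢ Icc 0 T) := by
  rintro ⟨x, t⟩ hxt
  have ht : t ∈ Icc 0 T := (mem_prod.1 hxt).2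
  obtain ⟨p, hxp, -⟩ := PS.cover x
  set κ := PS.chart p with hκ
  have hxe : x ∈ (extChartAt I κ.z).source := by rw [← FramedChart.source_eq]; exact hxp
  have hxs : x ∈ (chartAt H κ.z).source := by rwa [← extChartAt_source I κ.z]
  have hsrc : (x, t) ∈ (chartAt (ModelProd H ℝ) (κ.z, t)).source := by
    simp [prodChartedSpace_chartAt, hxs]
  rw [contMDiffWithinAt_iff_of_mem_source (I := I.prod 𝓘(ℝ, ℝ)) (I' := 𝓘(ℝ, W')) (n := ∞) hsrc (y := G t x) (by simp)]
  have hexte : extChartAt (I.prod 𝓘(ℝ, ℝ)) (κ.z, t) = (extChartAt I κ.z).prod (PartialEquiv.refl ℝ) := by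
    rw [extChartAt_prod, extChartAt_model_space_eq_id]
  have hη : extChartAt I κ.z x ∈ (extChartAt I κ.z).target := (extChartAt I κ.z).map_source hxe
  -- the chart expression `Ψ (η, τ) = (uncurry fun s y ↦ G s (κ.inv y)) (τ, κ.affine η)`
  set Ψ : E × ℝ → W' := fun q ↦ (uncurry fun s y ↦ G s (κ.inv y)) (q.2, κ.affine q.1) with hΨ
  have hexpr : ∀ q : E × ℝ, (fun p : M × ℝ ↦ G p.2 p.1) (((extChartAt I κ.z).prod (PartialEquiv.refl ℝ)).symm q) = Ψ q := by
    rintro ⟨η, τ⟩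
    have h := congrFun (κ.comp_extChartAt_symm_eq (G τ)) η
    simp only [Function.comp_apply] at h
    rw [PartialEquiv.prod_symm, PartialEquiv.prod_coe]
    exact h
  have hsm : ContDiffWithinAt ℝ ∞ Ψ ((extChartAt I κ.z).target ×ˢ Icc 0 T) (extChartAt I κ.z x, t) := by
    have h1 : ContDiffWithinAt ℝ ∞ (uncurry fun s y ↦ G s (κ.inv y)) (Icc 0 T ×ˢ κ.target) (t, κ.affine (extChartAt I κ.z x)) :=
      hG p (t, κ.affine (extChartAt I κ.z x)) (mk_mem_prod ht (κ.affine_mem_target hη))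
    refine h1.comp (extChartAt I κ.z x, t) (contDiffWithinAt_snd.prodMk (κ.contDiff_affine.contDiffWithinAt.comp _ contDiffWithinAt_fst (mapsTo_univ _ _))) ?_
    rintro ⟨η, τ⟩ hq
    exact mk_mem_prod (mem_prod.1 hq).2 (κ.affine_mem_target (mem_prod.1 hq).1)
  -- the neighbourhood `S' = (univ × Icc) ∩ (source × univ)` on which `f = Ψ ∘ (ext × id)`
  set S' : Set (M × ℝ) := univ ×ˢ Icc 0 T ∩ (extChartAt I κ.z).source ×ˢ univ with hS'
  have hS'mem : (x, t) ∈ S' := ⟨hxt, mk_mem_prod hxe (mem_univ _)⟩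
  have hnhd : S' ∈ 𝓝[univ ×ˢ Icc 0 T] ((x, t) : M × ℝ) :=
    inter_mem self_mem_nhdsWithin (mem_nhdsWithin_of_mem_nhds (((isOpen_extChartAt_source κ.z).prod isOpen_univ).mem_nhds (mk_mem_prod hxe (mem_univ _))))
  have heq : ∀ p' ∈ S', (fun p : M × ℝ ↦ G p.2 p.1) p' = Ψ (extChartAt I κ.z p'.1, p'.2) := by
    rintro ⟨x', t'⟩ ⟨-, h2⟩
    have hx' : x' ∈ (extChartAt I κ.z).source := (mem_prod.1 h2).1
    have h := hexpr (extChartAt I κ.z x', t')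
    rw [PartialEquiv.prod_symm, PartialEquiv.prod_coe] at h
    simp only [PartialEquiv.refl_symm, PartialEquiv.refl_coe, id_eq, (extChartAt I κ.z).left_inv hx'] at h
    exact h
  refine ⟨?_, ?_⟩
  · -- continuity within at `(x, t)`
    have hc1 : ContinuousWithinAt Ψ ((extChartAt I κ.z).target ×ˢ Icc 0 T) (extChartAt I κ.z x, t) := hsm.continuousWithinAt
    have hc2 : ContinuousWithinAt (fun p : M × ℝ ↦ ((extChartAt I κ.z p.1, p.2) : E × ℝ)) S' (x, t) := by
      have h : ContinuousAt (extChartAt I κ.z) x := continuousAt_extChartAt' hxe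
      exact ((h.comp continuousAt_fst).prodMk continuousAt_snd).continuousWithinAt
    have hmaps : MapsTo (fun p : M × ℝ ↦ ((extChartAt I κ.z p.1, p.2) : E × ℝ)) S' ((extChartAt I κ.z).target ×ˢ Icc 0 T) := by
      rintro ⟨x', t'⟩ ⟨h1, h2⟩
      exact mk_mem_prod ((extChartAt I κ.z).map_source (mem_prod.1 h2).1) (mem_prod.1 h1).2
    have hc3 : ContinuousWithinAt (fun p : M × ℝ ↦ Ψ (extChartAt I κ.z p.1, p.2)) S' (x, t) :=
      ContinuousWithinAt.comp (f := fun p : M × ℝ ↦ ((extChartAt I κ.z p.1, p.2) : E × ℝ)) (g := Ψ) hc1 hc2 hmaps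
    have hc4 : ContinuousWithinAt (fun p : M × ℝ ↦ G p.2 p.1) S' (x, t) := hc3.congr (fun p' hp' ↦ heq p' hp') (heq (x, t) hS'mem)
    exact hc4.mono_of_mem_nhdsWithin hnhd
  · -- smoothness of the chart expression
    rw [hexte]
    simp only [extChartAt_model_space_eq_id, PartialEquiv.refl_coe, id_comp]
    have hfun : ((fun p : M × ℝ ↦ G p.2 p.1) ∘ ((extChartAt I κ.z).prod (PartialEquiv.refl ℝ)).symm) = Ψ := funext fun q ↦ hexpr q
    rw [hfun]
    have hpt : ((extChartAt I κ.z).prod (PartialEquiv.refl ℝ)) (x, t) = (extChartAt I κ.z x, t) := rfl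
    rw [hpt]
    refine hsm.mono_of_mem_nhdsWithin ?_
    refine mem_nhdsWithin.2 ⟨(extChartAt I κ.z).target ×ˢ univ, (isOpen_extChartAt_target κ.z).prod isOpen_univ, mk_mem_prod hη (mem_univ _), ?_⟩
    rintro ⟨η, τ⟩ ⟨h1, h2⟩
    refine mk_mem_prod (mem_prod.1 h1).1 ?_
    have h3 := h2.1
    rw [mem_preimage, PartialEquiv.prod_symm, PartialEquiv.prod_coe] at h3
    simp only [PartialEquiv.refl_symm, PartialEquiv.refl_coe, id_eq, mem_prod, mem_univ, true_and] at h3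
    exact h3

end Glue

/-! ### The core existence theorem -/

section Core

variable {E : Type*} [NormedAddCommGroup E] [NormedSpace ℝ E] [FiniteDimensional ℝ E] {H : Type*} [TopologicalSpace H]
variable {I : ModelWithCorners ℝ E H} {M : Type*} [TopologicalSpace M] [ChartedSpace H M]
variable {W' : Type*} [NormedAddCommGroup W'] [InnerProductSpace ℝ W'] [FiniteDimensional ℝ W']
variable {ιb : Type*} [Fintype ιb]

set_option maxHeartbeats 4000000 in
/-- **Short-time existence for quasilinear strictly parabolic systems on a closed manifold**
(core: values in an inner product space, model of positive dimension). For `P` represented in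
the extended charts by a smooth, symmetric, positive definite top-order coefficient `a` and a
smooth lower-order part `f` on the open jet set `𝒪`, and a smooth `u₀` with graph in `𝒪`, there
is `ε > 0` and `u` jointly smooth on `M × [0, ε]` with `u(·, 0) = u₀`, graph in `𝒪`, and
`∂ₜ u = P(u)` within `[0, ε]` at every point. [cite: TaylorPDEIII2011, Ch. 15, §7]
[cite: MantegazzaMartinazzi2012, Thm. 1.1] -/
theorem quasilinear_shortTime_existence_core [Nontrivial E] [I.Boundaryless] [T2Space M] [CompactSpace M] [IsManifold I ∞ M]
    (b : Module.Basis ιb ℝ E) {𝒪 : Set (M × W')} (h𝒪 : IsOpen 𝒪) (P : (M → W') → M → W')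
    (a : M → E × W' × (E →L[ℝ] W') → ιb → ιb → ℝ) (f : M → E × W' × (E →L[ℝ] W') → W')
    (ha : ∀ z i i', ContDiffOn ℝ ∞ (fun j ↦ a z j i i') {j | j.1 ∈ (extChartAt I z).target ∧ ((extChartAt I z).symm j.1, j.2.1) ∈ 𝒪})
    (hf : ∀ z, ContDiffOn ℝ ∞ (f z) {j | j.1 ∈ (extChartAt I z).target ∧ ((extChartAt I z).symm j.1, j.2.1) ∈ 𝒪})
    (hstruct : ∀ z (j : E × W' × (E →L[ℝ] W')), j.1 ∈ (extChartAt I z).target → ((extChartAt I z).symm j.1, j.2.1) ∈ 𝒪 →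
      (∀ i i', a z j i i' = a z j i' i) ∧ ∀ ξ : ιb → ℝ, ξ ≠ 0 → 0 < ∑ i, ∑ i', a z j i i' * ξ i * ξ i')
    (hP : ∀ u : M → W', ContMDiff I 𝓘(ℝ, W') ∞ u → (∀ x, (x, u x) ∈ 𝒪) → ∀ z, ∀ y ∈ (extChartAt I z).target,
      P u ((extChartAt I z).symm y) =
        (∑ i, ∑ i', a z (y, u ((extChartAt I z).symm y), fderiv ℝ (u ∘ (extChartAt I z).symm) y) i i' •
          fderiv ℝ (fderiv ℝ (u ∘ (extChartAt I z).symm)) y (b i) (b i')) +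
        f z (y, u ((extChartAt I z).symm y), fderiv ℝ (u ∘ (extChartAt I z).symm) y))
    (u₀ : M → W') (hu₀ : ContMDiff I 𝓘(ℝ, W') ∞ u₀) (hg₀ : ∀ x, (x, u₀ x) ∈ 𝒪) :
    ∃ ε : ℝ, 0 < ε ∧ ∃ u : M → ℝ → W',
      ContMDiffOn (I.prod 𝓘(ℝ, ℝ)) 𝓘(ℝ, W') ∞ (fun p : M × ℝ ↦ u p.1 p.2) (univ ×ˢ Icc 0 ε) ∧
      (∀ x, u x 0 = u₀ x) ∧ (∀ t ∈ Icc (0 : ℝ) ε, ∀ x, (x, u x t) ∈ 𝒪) ∧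
      ∀ t ∈ Icc (0 : ℝ) ε, ∀ x, HasDerivWithinAt (u x) (P (fun x' ↦ u x' t) x) (Icc 0 ε) t := by
  classical
  /- ## the Euclidean model and an adapted patch system -/
  set n : ℕ := Module.finrank ℝ E with hn
  have hn1 : 1 ≤ n := Module.finrank_pos
  haveI : Nontrivial (EuclideanSpace ℝ (Fin n)) := by
    have h : 0 < Module.finrank ℝ (EuclideanSpace ℝ (Fin n)) := by simp; omega
    exact Module.finrank_pos_iff.1 h
  set A₀ : E ≃L[ℝ] EuclideanSpace ℝ (Fin n) := ContinuousLinearEquiv.ofFinrankEq (by simp [hn]) with hA₀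
  have hnE : Module.finrank ℝ (EuclideanSpace ℝ (Fin n)) = n := by simp
  -- the closeness parameter
  set η : ℝ := 1 / (4 * ((n : ℝ) + 1) ^ 2) with hη
  have hη0 : 0 < η := by positivity
  have hη1 : η ≤ 4⁻¹ := by
    rw [hη, div_le_iff₀ (by positivity)]
    have : (1 : ℝ) ≤ ((n : ℝ) + 1) ^ 2 := by nlinarith [show (0 : ℝ) ≤ n from Nat.cast_nonneg _]
    nlinarith
  have hsmall16 : 16 * (Module.finrank ℝ (EuclideanSpace ℝ (Fin n)) : ℝ) ^ 3 * η ^ 2 ≤ 1 := by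
    rw [hnE, hη]
    have hn0 : (0 : ℝ) ≤ n := Nat.cast_nonneg _
    rw [div_pow, one_pow, mul_pow, ← mul_div_assoc, div_le_one (by positivity)]
    have h4 : (4 : ℝ) ^ 2 = 16 := by norm_num
    rw [h4]
    have : (n : ℝ) ^ 3 ≤ ((n : ℝ) + 1) ^ 3 := pow_le_pow_left₀ hn0 (by linarith) 3
    have : ((n : ℝ) + 1) ^ 3 ≤ ((n : ℝ) + 1) ^ 2 * ((n : ℝ) + 1) ^ 2 := by nlinarith
    nlinarith
  obtain ⟨tM, PS, -, hadapt⟩ := exists_adapted_patchSystem (I := I) (M := M) (b := b) (a := a) (u₀ := u₀) (W := W') A₀ ha hstruct hu₀ hg₀ hη0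
  /- ## the data of the scheme -/
  have huh : ∀ q, ContDiffOn ℝ ∞ (u₀ ∘ (PS.chart q).inv) (PS.chart q).target := fun q ↦ (PS.chart q).contDiffOn_comp_inv hu₀
  have hgq : ∀ q, ∀ y ∈ (PS.chart q).target, ((PS.chart q).inv y, u₀ ((PS.chart q).inv y)) ∈ 𝒪 := fun q y _ ↦ hg₀ _
  obtain ⟨ρ, hρ, hKΩ⟩ := exists_jet_radius PS h𝒪 huh hg₀
  set n' : ℝ := (Module.finrank ℝ (EuclideanSpace ℝ (Fin n)) : ℝ) with hn'
  set ρ' : ℝ := ρ / (2 * (n' + 1)) with hρ'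
  have hn'0 : 0 ≤ n' := Nat.cast_nonneg _
  have hρ'0 : 0 < ρ' := by positivity
  have hρρ : 2 * (n' + 1) * ρ' ^ 2 ≤ ρ ^ 2 := by
    rw [hρ', div_pow, mul_pow]
    have h1 : 2 * (n' + 1) * (ρ ^ 2 / (2 ^ 2 * (n' + 1) ^ 2)) = ρ ^ 2 / (2 * (n' + 1)) := by field_simp
    rw [h1, div_le_iff₀ (by positivity)]
    nlinarith [sq_nonneg ρ]
  set D : PicardData I M (EuclideanSpace ℝ (Fin n)) W' ιb ↥tM :=
    { PS := PS, b := b, 𝒪 := 𝒪, P := P, a := a, f := f, u₀ := u₀, ρ := ρ, ρ' := ρ', h𝒪 := h𝒪, ha := fun p ↦ ha _, hf := fun p ↦ hf _,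
      hP := fun p u hu hg η' hη' ↦ hP u hu hg _ η' hη', hu₀ := hu₀, hg₀ := hg₀, hρ := hρ, hρ' := hρ'0, hρρ := hρρ, hKΩ := hKΩ } with hD
  /- ## the frozen fields and the chart representation of `L` -/
  set S₀ : ↥tM → EuclideanSpace ℝ (Fin n) → (EuclideanSpace ℝ (Fin n) →L[ℝ] EuclideanSpace ℝ (Fin n)) := fun q ↦ linSymb (PS.chart q) b a u₀ with hS₀
  set 𝔟₀ : ↥tM → EuclideanSpace ℝ (Fin n) → ((EuclideanSpace ℝ (Fin n) →L[ℝ] W') →L[ℝ] W') := fun q ↦ linFirst (PS.chart q) b a f u₀ with h𝔟₀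
  set 𝔠₀ : ↥tM → EuclideanSpace ℝ (Fin n) → (W' →L[ℝ] W') := fun q ↦ linZero (PS.chart q) b a f u₀ with h𝔠₀
  have hS₀s : ∀ q, ContDiffOn ℝ ∞ (S₀ q) (PS.chart q).target := fun q ↦ contDiffOn_linSymb (ha _) (huh q) (hgq q)
  have h𝔟₀s : ∀ q, ContDiffOn ℝ ∞ (𝔟₀ q) (PS.chart q).target := fun q ↦ contDiffOn_linFirst (ha _) (hf _) h𝒪 (huh q) (hgq q)
  have h𝔠₀s : ∀ q, ContDiffOn ℝ ∞ (𝔠₀ q) (PS.chart q).target := fun q ↦ contDiffOn_linZero (ha _) (hf _) h𝒪 (huh q) (hgq q)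
  have hL : ∀ u : M → W', (∀ q, ContDiffOn ℝ ∞ (u ∘ (PS.chart q).inv) (PS.chart q).target) →
      ∀ q, ∀ y ∈ (PS.chart q).target, linOp P u₀ u ((PS.chart q).inv y) = frameOp (S₀ q y) (𝔟₀ q y) (𝔠₀ q y) (u ∘ (PS.chart q).inv) y :=
    fun u hu q y hy ↦ linOp_inv_eq_frameOp (κ := PS.chart q) (b := b) (a := a) (f := f) (u₀ := u₀) h𝒪 (ha _) (hf _) (fun u' hu' hg' η' hη' ↦ hP u' hu' hg' _ η' hη') hu₀ hg₀
      (PatchSystemLoc.contMDiff_of_chartSmooth PS hu) hy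
  -- slab-smoothness of the (time-independent) fields on any slab
  have hSt : ∀ T' q, ContDiffOn ℝ ∞ (uncurry fun (_ : ℝ) y ↦ S₀ q y) (Icc 0 T' ×ˢ (PS.chart q).target) := fun T' q ↦
    (hS₀s q).comp contDiffOn_snd fun w hw ↦ (mem_prod.1 hw).2
  have h𝔟t : ∀ T' q, ContDiffOn ℝ ∞ (uncurry fun (_ : ℝ) y ↦ 𝔟₀ q y) (Icc 0 T' ×ˢ (PS.chart q).target) := fun T' q ↦
    (h𝔟₀s q).comp contDiffOn_snd fun w hw ↦ (mem_prod.1 hw).2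
  have h𝔠t : ∀ T' q, ContDiffOn ℝ ∞ (uncurry fun (_ : ℝ) y ↦ 𝔠₀ q y) (Icc 0 T' ×ˢ (PS.chart q).target) := fun T' q ↦
    (h𝔠₀s q).comp contDiffOn_snd fun w hw ↦ (mem_prod.1 hw).2
  have hηS : ∀ T' q, ∀ s ∈ Icc (0 : ℝ) T', ∀ y ∈ closedBall (0 : EuclideanSpace ℝ (Fin n)) (4 * PS.r q), ‖(fun (_ : ℝ) y ↦ S₀ q y) s y - 1‖ ≤ η :=
    fun T' q s _ y hy ↦ hadapt q y hy
  -- from the `linOp` form of an equation to the chart form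
  have hchart : ∀ {T' : ℝ} {v g : ℝ → M → W'}, (∀ q, ContDiffOn ℝ ∞ (uncurry fun s y ↦ v s ((PS.chart q).inv y)) (Icc 0 T' ×ˢ (PS.chart q).target)) →
      (∀ s ∈ Icc 0 T', ∀ x, derivWithin (fun s ↦ v s x) (Icc 0 T') s = linOp P u₀ (v s) x + g s x) →
      ∀ p, ∀ s ∈ Icc 0 T', ∀ y ∈ (PS.chart p).target,
        timeDerivWithin (Icc 0 T') (fun s y ↦ v s ((PS.chart p).inv y)) s y =
          frameOp ((fun (_ : ℝ) y ↦ S₀ p y) s y) ((fun (_ : ℝ) y ↦ 𝔟₀ p y) s y) ((fun (_ : ℝ) y ↦ 𝔠₀ p y) s y) (fun y ↦ v s ((PS.chart p).inv y)) y +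
            g s ((PS.chart p).inv y) := by
    intro T' v g hv hlin p s hs y hy
    rw [timeDerivWithin, hlin s hs, hL (v s) (PatchSystemLoc.chartSmooth_slice PS hv hs) p y hy]
    rfl
  /- ## the a priori estimate with the order-independent constant -/
  set Clin : ℝ≥0∞ := ((Module.finrank ℝ (EuclideanSpace ℝ (Fin n)) : ℝ≥0∞) + 2) * (32 * (Fintype.card ↥tM : ℝ≥0∞)) with hClin
  have hClintop : Clin ≠ ⊤ := ENNReal.mul_ne_top (by simp) (ENNReal.mul_ne_top (by norm_num) (ENNReal.natCast_ne_top _))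
  have hAp : ∀ i : ℕ, ∃ Λ : ℝ, 1 ≤ Λ ∧ ∀ {lam : ℝ}, Λ ≤ lam → ∀ {T' : ℝ}, 0 < T' → T' ≤ 1 → ∀ {v g : ℝ → M → W'},
      (∀ q, ContDiffOn ℝ ∞ (uncurry fun s y ↦ v s ((D.PS.chart q).inv y)) (Icc 0 T' ×ˢ (D.PS.chart q).target)) →
      (∀ x, v 0 x = 0) →
      (∀ q, ContDiffOn ℝ ∞ (uncurry fun s y ↦ g s ((D.PS.chart q).inv y)) (Icc 0 T' ×ˢ (D.PS.chart q).target)) →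
      (∀ s ∈ Icc 0 T', ∀ x, derivWithin (fun s ↦ v s x) (Icc 0 T') s = linOp D.P D.u₀ (v s) x + g s x) →
      ∀ t ∈ Icc 0 T',
        (∑ p, PatchSystemLoc.maxRegQ i lam (fun s ↦ PatchSystemLoc.cutExpr D.PS p (v s)) t ≤
          Clin * ∑ p, ∫⁻ s in Ioo 0 t, ENNReal.ofReal (Real.exp (-2 * lam * s)) * sobolevEnergy i (PatchSystemLoc.cutExpr D.PS p (g s))) ∧
        ∀ p, ENNReal.ofReal (Real.exp (-2 * lam * t)) * sobolevEnergy i (PatchSystemLoc.cutExpr D.PS p (v t)) ≤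
          Clin * ENNReal.ofReal lam⁻¹ * ∑ p, ∫⁻ s in Ioo 0 t, ENNReal.ofReal (Real.exp (-2 * lam * s)) * sobolevEnergy i (PatchSystemLoc.cutExpr D.PS p (g s)) := by
    intro i
    obtain ⟨Λ, hΛ1, hap⟩ := PatchSystemLoc.maxreg_apriori_le_explicit PS one_pos i (S := fun p (_ : ℝ) y ↦ S₀ p y) (𝔟 := fun p (_ : ℝ) y ↦ 𝔟₀ p y)
      (𝔠 := fun p (_ : ℝ) y ↦ 𝔠₀ p y) (hSt 1) (h𝔟t 1) (h𝔠t 1) hη0.le (hηS 1) hsmall16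
    refine ⟨Λ, hΛ1, fun {lam} hlam {T'} hT' hT'1 {v g} hv hv0 hg hlin t ht ↦ ?_⟩
    exact hap hlam hT' hT'1 hv hv0 hg (hchart hv hlin) t ht
  /- ## linear existence -/
  have hν₀ : (0 : ℝ) < 1 - η := by linarith
  have hsym : ∀ p, ∀ y ∈ closedBall (0 : EuclideanSpace ℝ (Fin n)) (4 * PS.r p), ContinuousLinearMap.adjoint ((fun (_ : ℝ) y ↦ S₀ p y) 0 y) = (fun (_ : ℝ) y ↦ S₀ p y) 0 y :=
    fun p y hy ↦ (adjoint_linSymb_and_pos (κ := PS.chart p) (b := b) (a := a) (u₀ := u₀) (hstruct _) (hgq p) (PS.closedBall_subset_target p le_rfl hy)).1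
  have hcoer : ∀ p, ∀ y ∈ closedBall (0 : EuclideanSpace ℝ (Fin n)) (4 * PS.r p), ∀ ξ : EuclideanSpace ℝ (Fin n),
      (1 - η) * ‖ξ‖ ^ 2 ≤ ⟪(fun (_ : ℝ) y ↦ S₀ p y) 0 y ξ, ξ⟫ := by
    intro p y hy ξ
    have hS1 := hadapt p y hy
    have h1 : ⟪S₀ p y ξ, ξ⟫ = ‖ξ‖ ^ 2 + ⟪(S₀ p y - 1) ξ, ξ⟫ := by
      have h := inner_sub_left (𝕜 := ℝ) (S₀ p y ξ) ξ ξ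
      simp only [FunLike.coe_sub, Pi.sub_apply, ContinuousLinearMap.coe_id', id_eq, ContinuousLinearMap.one_def] at h ⊢
      rw [real_inner_self_eq_norm_sq] at h; linarith
    have h2 : |⟪(S₀ p y - 1) ξ, ξ⟫| ≤ η * ‖ξ‖ ^ 2 :=
      calc |⟪(S₀ p y - 1) ξ, ξ⟫| ≤ ‖(S₀ p y - 1) ξ‖ * ‖ξ‖ := abs_real_inner_le_norm _ _
        _ ≤ ‖S₀ p y - 1‖ * ‖ξ‖ * ‖ξ‖ := mul_le_mul_of_nonneg_right ((S₀ p y - 1).le_opNorm ξ) (norm_nonneg _)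
        _ ≤ η * ‖ξ‖ * ‖ξ‖ := mul_le_mul_of_nonneg_right (mul_le_mul_of_nonneg_right hS1 (norm_nonneg _)) (norm_nonneg _)
        _ = η * ‖ξ‖ ^ 2 := by ring
    show (1 - η) * ‖ξ‖ ^ 2 ≤ ⟪S₀ p y ξ, ξ⟫
    rw [h1]
    have := neg_abs_le ⟪(S₀ p y - 1) ξ, ξ⟫
    nlinarith
  have hosc : ∀ T' p, ∀ s ∈ Icc (0 : ℝ) T', ∀ y ∈ closedBall (0 : EuclideanSpace ℝ (Fin n)) (4 * PS.r p), ‖(fun (_ : ℝ) y ↦ S₀ p y) s y - (fun (_ : ℝ) y ↦ S₀ p y) 0 y‖ ≤ 0 :=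
    fun T' p s _ y _ ↦ by simp
  have hεo : 2 * Real.sqrt (3840 * (Module.finrank ℝ (EuclideanSpace ℝ (Fin n)) : ℝ) ^ 3 *
      (10 * Real.sqrt (Module.finrank ℝ (EuclideanSpace ℝ (Fin n))) + 1) ^ (2 * Module.finrank ℝ (EuclideanSpace ℝ (Fin n))) *
        (Module.finrank ℝ (EuclideanSpace ℝ (Fin n))).factorial) * (0 : ℝ) ≤ min 1 (1 - η) := by
    rw [mul_zero]; exact le_min zero_le_one hν₀.le
  have hLin : ∀ {T' : ℝ}, 0 < T' → T' ≤ 1 → ∀ {Θ : ℝ → M → W'},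
      (∀ q, ContDiffOn ℝ ∞ (uncurry fun s y ↦ Θ s ((D.PS.chart q).inv y)) (Icc 0 T' ×ˢ (D.PS.chart q).target)) →
      ∃ v : ℝ → M → W', (∀ q, ContDiffOn ℝ ∞ (uncurry fun s y ↦ v s ((D.PS.chart q).inv y)) (Icc 0 T' ×ˢ (D.PS.chart q).target)) ∧
        (∀ x, v 0 x = 0) ∧ ∀ s ∈ Icc 0 T', ∀ x, derivWithin (fun s ↦ v s x) (Icc 0 T') s = linOp D.P D.u₀ (v s) x + Θ s x := by
    intro T' hT' _ Θ hΘ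
    exact PatchSystemLoc.exists_linSolution (P := PS) (L := fun _ ↦ linOp P u₀) hT' (hSt T') (h𝔟t T') (h𝔠t T')
      (fun s _ u hu p y hy ↦ hL u hu p y hy) hsym hν₀ hcoer (hosc T') hεo hη0.le (hηS T') hsmall16 hΘ
  /- ## the solution -/
  obtain ⟨T, hT0, v, hvs, hv0, hgraph, hode⟩ := D.exists_solution hClintop hLin hAp hS₀s h𝔟₀s h𝔠₀s hL
  refine ⟨T, hT0, fun x t ↦ u₀ x + v t x, ?_, fun x ↦ by simp [hv0 x], fun t ht x ↦ hgraph t ht x, fun t ht x ↦ hode t ht x⟩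
  -- joint smoothness on `M × [0, T]`
  have h1 : ContMDiffOn (I.prod 𝓘(ℝ, ℝ)) 𝓘(ℝ, W') ∞ (fun p : M × ℝ ↦ u₀ p.1) (univ ×ˢ Icc 0 T) := (hu₀.comp contMDiff_fst).contMDiffOn
  have h2 := PatchSystemLoc.contMDiffOn_prod_of_chartSlabSmooth PS hvs
  exact h1.add h2

end Core

end Literature.Analysis.PDE
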